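import Summits.CriticalPhenomena.PercolationContinuityZ3.Theorems.Transplant.FKConnectivityAllQEdgeLocal
import Summits.CriticalPhenomena.PercolationContinuityZ3.Theorems.PercNearOneGluingNoHeavyLowerTailCoSunflowerGlue
import HarnessLib

/-!
# Connectivity correlation inequalities for `φ_{w,q}`, every `q > 0` — file 9a: apex elimination, TOOLS
# (graph lemmas at a degree-2 apex, almost-sure bookkeeping for masses, the apex hypothesis)

Support file (`--supports stmt-CriticalPhenomena-4575`), FK sub-lane `prim-bschramm-fk-1` (gen 5) of the post-continuity
programme; builds on p205010 (kernel theorem, internal audit signed; external expert review pending).  No definitions, no named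
facts, no sorries; standard axioms.

THE ARGUMENT (files `…ApexTools`, `…ApexMass`, `…ApexCases`, `…ApexStep`, `…TwoTree`).  Wagner (Ann. Comb. 2008, Ex. 5.1 +
Thm. 5.8(d) + §5.3) proves that the random-cluster (Potts) model with `0 < q ≤ 1` is Rayleigh — edge-negatively associated,
`φ(J_e ∩ J_f) ≤ φ(J_e)φ(J_f)` (Grimmett 2006 §3.9 (3.94)) — on every series–parallel graph, by induction over two-sums.  We prove the
graph case by APEX ELIMINATION over 2-trees (whose subgraphs are exactly the series–parallel = `K₄`-minor-free graphs): a 2-tree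
is `{uv}` or `T ∪ {ux, xv}` with `uv ∈ T` and `x` fresh; for a weight vector `w` supported in `T ∪ {ux, xv}` write `a = ux`,
`b = xv`, `g = uv`, `w° = w[a↦0][b↦0]` and `K' = {u ↔ v avoiding a, b}`.  Three exact identities for events `F` insensitive to
`a, b` (file `…ApexMass`): `S_w(F) = ((1−p_a)+p_a q⁻¹)((1−p_b)+p_b q⁻¹)·S°(F) − p_a p_b q⁻¹(q⁻¹−1)·S°(F ∩ K')`,
`S_w(J_b ∩ F ∩ K') = p_b q⁻¹·S°(F ∩ K')`, `S_w(J_a ∩ J_b ∩ F) = p_a p_b (q⁻¹ S°(F) + (q⁻¹−1)q⁻¹ S°(F ∩ K'ᶜ))`.  With fk-2's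
master identity (`negCorr_defect_eq`: `Cov(J_e, J_f) ≤ 0 ⟺` opening `f` does not lower `φ_{w[e↦0]}(x ↔ y)`, `e = xy`) every pair
reduces to EC⁺ for `u ↔ v` one level down, i.e. to negative association on `T` (file `…ApexCases`): `(a, f)`:
`φ_{w[a↦0][f↦s]}(u ↔ x) = θ·φ_{w°[f↦s]}(u ↔ v)`; `(g, f)`: `φ_{w[g↦0][f↦s]}(u ↔ v)` is an increasing Möbius function of
`φ_{w°[g↦0][f↦s]}(u ↔ v)`; `(a, b)`, `(a, g)`: unconditional; and pairs `e, f ⊆ T ∖ g` are MARGINALISED (file `…ApexStep`):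
`S_w(E) = α·S_{w°[g↦c]}(E)` for `E ∈ {J_e ∩ J_f, J_e, J_f, Ω}` with `α = (1−p_a)(1−p_b) + (p_a+p_b−p_ap_b)q⁻¹` and
`α c = α p_g + (1−p_g)p_a p_b q⁻¹` (the path `u–x–v` is a pair `uv` in parallel with `g`).

THIS FILE: reachability at an apex `x` whose open pairs lie in `{ux, xv}` (`reachable_uv_apex_iff`, `reachable_ux_apex_iff`);
masses of almost surely equal / empty / sure events; the apex hypothesis 'every live pair at `x` contains `u` or `v`' and its
almost-sure consequences; insensitivity of `K'` to the apex pairs.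
[cite: Wagner2006, Ex. 5.1, Thm. 5.8(d), §5.3] [cite: Grimmett2006, §3.9 eq. (3.94) (pp. 63–64); §1.4 eq. (1.20) (p. 15); Thm. (3.1)(a) (p. 37)]
-/

noncomputable section

namespace Summit.CriticalPhenomena.PercolationContinuityZ3.Theorems

namespace FK

open MeasureTheory Set Literature.Probability.LatticeModels Literature.Probability.Percolation
open Literature.Probability.Percolation.DecisionTree (ind ind_of_mem ind_of_not_mem ind_nonneg)
open Literature.Probability.Percolation.TwoAvoidanceSets (ind_mul_ind)
open scoped Classical symmDiff

variable {V : Type*} [Fintype V]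

/-! ### Graph lemmas at an apex `x` whose open pairs lie in `{ux, xv}` -/

omit [Fintype V] in
/-- An isolated vertex reaches only itself. [folklore] -/
theorem not_reachable_of_isolated {ω : BondConfig V} {x z : V} (hx : ∀ e ∈ ω, x ∉ e) (hz : z ≠ x) :
    ¬ (openGraph ω).Reachable x z := by
  rintro ⟨p⟩
  cases p with
  | nil => exact hz rfl
  | cons h _ =>
    rw [openGraph_adj] at h
    exact hx _ h.1 (Sym2.mem_mk_left _ _)

omit [Fintype V] in
/-- An isolated vertex reaches only itself (symmetric form). [folklore] -/
theorem not_reachable_of_isolated' {ω : BondConfig V} {x z : V} (hx : ∀ e ∈ ω, x ∉ e) (hz : z ≠ x) :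
    ¬ (openGraph ω).Reachable z x := fun h => not_reachable_of_isolated hx hz h.symm

omit [Fintype V] in
/-- Removing the two apex pairs isolates the apex. [folklore] -/
theorem isolated_diff_apex {ω : BondConfig V} {u v x : V}
    (hω : ∀ e ∈ ω, x ∈ e → e = s(u, x) ∨ e = s(x, v)) :
    ∀ e ∈ ω \ {s(u, x), s(x, v)}, x ∉ e := by
  intro e he hxe
  rcases hω e he.1 hxe with rfl | rfl
  · exact he.2 (Or.inl rfl)
  · exact he.2 (Or.inr rfl)

omit [Fintype V] in
/-- **Apex lemma G1**: if the open pairs at `x` lie in `{ux, xv}` (`x ∉ {u,v}`), then `u ↔ v` iff `u ↔ v` avoiding the apex pairs,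
or both apex pairs are open. [folklore] -/
theorem reachable_uv_apex_iff {ω : BondConfig V} {u v x : V} (hxu : x ≠ u) (hxv : x ≠ v)
    (hω : ∀ e ∈ ω, x ∈ e → e = s(u, x) ∨ e = s(x, v)) :
    (openGraph ω).Reachable u v ↔
      (openGraph (ω \ {s(u, x), s(x, v)})).Reachable u v ∨ (s(u, x) ∈ ω ∧ s(x, v) ∈ ω) := by
  set ξ := ω \ {s(u, x), s(x, v)} with hξ
  have hiso := isolated_diff_apex hω
  have hxu' : ¬ (openGraph ξ).Reachable x u := not_reachable_of_isolated hiso hxu.symm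
  have hux' : ¬ (openGraph ξ).Reachable u x := not_reachable_of_isolated' hiso hxu.symm
  have hxv' : ¬ (openGraph ξ).Reachable x v := not_reachable_of_isolated hiso hxv.symm
  have hvx' : ¬ (openGraph ξ).Reachable v x := not_reachable_of_isolated' hiso hxv.symm
  by_cases ha : s(u, x) ∈ ω <;> by_cases hb : s(x, v) ∈ ω
  · -- both open: `u – x – v`
    simp only [ha, hb, and_self, or_true, iff_true]
    have h1 : (openGraph ω).Adj u x := by rw [openGraph_adj]; exact ⟨ha, hxu.symm⟩
    have h2 : (openGraph ω).Adj x v := by rw [openGraph_adj]; exact ⟨hb, hxv⟩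
    exact h1.reachable.trans h2.reachable
  · have hωeq : ω = insert s(u, x) ξ := by
      ext e
      simp only [hξ, Set.mem_insert_iff, Set.mem_sdiff, Set.mem_singleton_iff]
      constructor
      · intro he
        by_cases h : e = s(u, x)
        · exact Or.inl h
        · exact Or.inr ⟨he, fun h' => h'.elim h fun h'' => hb (h'' ▸ he)⟩
      · rintro (rfl | ⟨he, -⟩)
        · exact ha
        · exact he
    simp only [ha, hb, and_false, or_false]
    rw [hωeq, CoSunflowerGlue.openGraph_insert, CoSunflowerGlue.reachable_sup_edge_iff']
    constructor
    · rintro (h | ⟨-, h2⟩ | ⟨h1, -⟩)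
      · exact h
      · exact absurd h2 hxv'
      · exact absurd h1 hux'
    · exact fun h => Or.inl h
  · have hωeq : ω = insert s(x, v) ξ := by
      ext e
      simp only [hξ, Set.mem_insert_iff, Set.mem_sdiff, Set.mem_singleton_iff]
      constructor
      · intro he
        by_cases h : e = s(x, v)
        · exact Or.inl h
        · exact Or.inr ⟨he, fun h' => h'.elim (fun h'' => ha (h'' ▸ he)) h⟩
      · rintro (rfl | ⟨he, -⟩)
        · exact hb
        · exact he
    simp only [ha, hb, false_and, or_false]
    rw [hωeq, CoSunflowerGlue.openGraph_insert, CoSunflowerGlue.reachable_sup_edge_iff']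
    constructor
    · rintro (h | ⟨h1, -⟩ | ⟨-, h2⟩)
      · exact h
      · exact absurd h1 hux'
      · exact absurd h2 hxv'
    · exact fun h => Or.inl h
  · have hωeq : ω = ξ := by
      ext e
      simp only [hξ, Set.mem_sdiff, Set.mem_insert_iff, Set.mem_singleton_iff]
      constructor
      · intro he
        exact ⟨he, fun h' => h'.elim (fun h'' => ha (h'' ▸ he)) fun h'' => hb (h'' ▸ he)⟩
      · exact fun h => h.1
    simp only [ha, hb, and_self, or_false]
    rw [← hωeq]

omit [Fintype V] in
/-- **Apex lemma G2**: if the open pairs at `x` lie in `{ux, xv}` (`x ∉ {u,v}`), then `u ↔ x` iff `ux` is open, or `xv` is open and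
`u ↔ v` avoiding the apex pairs. [folklore] -/
theorem reachable_ux_apex_iff {ω : BondConfig V} {u v x : V} (hxu : x ≠ u) (hxv : x ≠ v)
    (hω : ∀ e ∈ ω, x ∈ e → e = s(u, x) ∨ e = s(x, v)) :
    (openGraph ω).Reachable u x ↔
      s(u, x) ∈ ω ∨ (s(x, v) ∈ ω ∧ (openGraph (ω \ {s(u, x), s(x, v)})).Reachable u v) := by
  set ξ := ω \ {s(u, x), s(x, v)} with hξ
  have hiso := isolated_diff_apex hω
  have hux' : ¬ (openGraph ξ).Reachable u x := not_reachable_of_isolated' hiso hxu.symm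
  have hvx' : ¬ (openGraph ξ).Reachable v x := not_reachable_of_isolated' hiso hxv.symm
  by_cases ha : s(u, x) ∈ ω
  · simp only [ha, true_or, iff_true]
    have h1 : (openGraph ω).Adj u x := by rw [openGraph_adj]; exact ⟨ha, hxu.symm⟩
    exact h1.reachable
  by_cases hb : s(x, v) ∈ ω
  · have hωeq : ω = insert s(x, v) ξ := by
      ext e
      simp only [hξ, Set.mem_insert_iff, Set.mem_sdiff, Set.mem_singleton_iff]
      constructor
      · intro he
        by_cases h : e = s(x, v)
        · exact Or.inl h
        · exact Or.inr ⟨he, fun h' => h'.elim (fun h'' => ha (h'' ▸ he)) h⟩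
      · rintro (rfl | ⟨he, -⟩)
        · exact hb
        · exact he
    simp only [ha, hb, true_and, false_or]
    rw [hωeq, CoSunflowerGlue.openGraph_insert, CoSunflowerGlue.reachable_sup_edge_iff']
    constructor
    · rintro (h | ⟨h1, -⟩ | ⟨h1, -⟩)
      · exact absurd h hux'
      · exact absurd h1 hux'
      · exact h1
    · exact fun h => Or.inr (Or.inr ⟨h, SimpleGraph.Reachable.refl _⟩)
  · have hωeq : ω = ξ := by
      ext e
      simp only [hξ, Set.mem_sdiff, Set.mem_insert_iff, Set.mem_singleton_iff]
      constructor
      · intro he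
        exact ⟨he, fun h' => h'.elim (fun h'' => ha (h'' ▸ he)) fun h'' => hb (h'' ▸ he)⟩
      · exact fun h => h.1
    simp only [ha, hb, false_and, or_false, iff_false]
    rw [hωeq]; exact hux'


/-! ### Almost-sure bookkeeping for masses -/

/-- Masses of almost surely equal events agree. [cite: Grimmett2006, §1.4 eq. (1.20) (p. 15)] -/
theorem sum_rcWeightW_ind_congr_ae (w : Sym2 V → unitInterval) (q : ℝ) {E₁ E₂ : Set (BondConfig V)}
    (h : ∀ ω, rcWeightW w q ∅ ω ≠ 0 → (ω ∈ E₁ ↔ ω ∈ E₂)) :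
    ∑ ω : BondConfig V, rcWeightW w q ∅ ω * ind E₁ ω = ∑ ω : BondConfig V, rcWeightW w q ∅ ω * ind E₂ ω := by
  refine Finset.sum_congr rfl fun ω _ => ?_
  by_cases hz : rcWeightW w q ∅ ω = 0
  · rw [hz, zero_mul, zero_mul]
  · by_cases h1 : ω ∈ E₁
    · rw [ind_of_mem h1, ind_of_mem ((h ω hz).1 h1)]
    · rw [ind_of_not_mem h1, ind_of_not_mem (fun h2 => h1 ((h ω hz).2 h2))]

/-- The mass of an almost surely empty event vanishes. [cite: Grimmett2006, §1.4 eq. (1.20) (p. 15)] -/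
theorem sum_rcWeightW_ind_eq_zero_ae (w : Sym2 V → unitInterval) (q : ℝ) {E : Set (BondConfig V)}
    (h : ∀ ω, rcWeightW w q ∅ ω ≠ 0 → ω ∉ E) :
    ∑ ω : BondConfig V, rcWeightW w q ∅ ω * ind E ω = 0 := by
  refine Finset.sum_eq_zero fun ω _ => ?_
  by_cases hz : rcWeightW w q ∅ ω = 0
  · rw [hz, zero_mul]
  · rw [ind_of_not_mem (h ω hz), mul_zero]

/-- The mass of an almost sure event is the partition function. [cite: Grimmett2006, §1.4 eq. (1.20) (p. 15)] -/
theorem sum_rcWeightW_ind_eq_Z_ae (w : Sym2 V → unitInterval) (q : ℝ) {E : Set (BondConfig V)}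
    (h : ∀ ω, rcWeightW w q ∅ ω ≠ 0 → ω ∈ E) :
    ∑ ω : BondConfig V, rcWeightW w q ∅ ω * ind E ω = rcPartitionFunctionW w q ∅ := by
  unfold rcPartitionFunctionW
  refine Finset.sum_congr rfl fun ω _ => ?_
  by_cases hz : rcWeightW w q ∅ ω = 0
  · rw [hz, zero_mul]
  · rw [ind_of_mem (h ω hz), mul_one]

/-- A mass is at most the partition function (`q ≥ 0`). [cite: Grimmett2006, §1.4 eq. (1.20) (p. 15)] -/
theorem sum_rcWeightW_ind_le_Z (w : Sym2 V → unitInterval) {q : ℝ} (hq : 0 ≤ q) (E : Set (BondConfig V)) :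
    ∑ ω : BondConfig V, rcWeightW w q ∅ ω * ind E ω ≤ rcPartitionFunctionW w q ∅ := by
  unfold rcPartitionFunctionW
  refine Finset.sum_le_sum fun ω _ => ?_
  have h0 := rcWeightW_nonneg w hq (∅ : Set V) ω
  by_cases h : ω ∈ E
  · rw [ind_of_mem h, mul_one]
  · rw [ind_of_not_mem h, mul_zero]; exact h0

/-- A pair of parameter `0` is almost surely closed. [cite: Grimmett2006, §1.4 eq. (1.20) (p. 15)] -/
theorem not_mem_of_rcWeightW_ne_zero (w : Sym2 V → unitInterval) (q : ℝ) {e : Sym2 V} (h0 : (w e : ℝ) = 0)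
    {ω : BondConfig V} (hω : rcWeightW w q ∅ ω ≠ 0) : e ∉ ω :=
  fun he => hω (rcWeightW_eq_zero_of_zero_mem w q ∅ h0 he)

/-- A pair of parameter `1` is almost surely open. [cite: Grimmett2006, §1.4 eq. (1.20) (p. 15)] -/
theorem mem_of_rcWeightW_ne_zero (w : Sym2 V → unitInterval) (q : ℝ) {e : Sym2 V} (h1 : (w e : ℝ) = 1)
    {ω : BondConfig V} (hω : rcWeightW w q ∅ ω ≠ 0) : e ∈ ω := by
  by_contra he
  exact hω (rcWeightW_eq_zero_of_one_not_mem w q ∅ h1 he)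

/-! ### The apex hypothesis: every live pair at `x` contains `u` or `v` -/

omit [Fintype V] in
/-- A pair containing `x` and `u ≠ x` is `s(u,x)`. [folklore] -/
theorem sym2_eq_mk_of_mem_of_mem {e : Sym2 V} {x u : V} (hx : x ∈ e) (hu : u ∈ e) (hux : u ≠ x) : e = s(u, x) := by
  induction e using Sym2.ind with
  | h a b =>
    rw [Sym2.mem_iff] at hx hu
    rcases hx with rfl | rfl <;> rcases hu with rfl | rfl
    · exact absurd rfl hux
    · exact Sym2.eq_swap
    · rfl
    · exact absurd rfl hux

omit [Fintype V] in
/-- The two apex pairs are distinct when `u ≠ v`. [folklore] -/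
theorem apex_pairs_ne {u v x : V} (hxu : x ≠ u) (huv : u ≠ v) : s(u, x) ≠ s(x, v) := by
  intro h
  rw [Sym2.eq_iff] at h
  rcases h with ⟨h1, _⟩ | ⟨h1, _⟩
  · exact hxu h1.symm
  · exact huv h1

/-- Under the apex hypothesis, almost surely the open pairs at `x` lie in `{ux, xv}`.
[cite: Grimmett2006, §1.4 eq. (1.20) (p. 15)] -/
theorem apex_of_rcWeightW_ne_zero (w : Sym2 V → unitInterval) (q : ℝ) {u v x : V} (hxu : x ≠ u) (hxv : x ≠ v)
    (hw : ∀ e : Sym2 V, x ∈ e → ((w e : unitInterval) : ℝ) ≠ 0 → u ∈ e ∨ v ∈ e)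
    {ω : BondConfig V} (hω : rcWeightW w q ∅ ω ≠ 0) :
    ∀ e ∈ ω, x ∈ e → e = s(u, x) ∨ e = s(x, v) := by
  intro e he hxe
  have hne : ((w e : unitInterval) : ℝ) ≠ 0 := fun h0 => not_mem_of_rcWeightW_ne_zero w q h0 hω he
  rcases hw e hxe hne with hu | hv
  · exact Or.inl (sym2_eq_mk_of_mem_of_mem hxe hu hxu.symm)
  · refine Or.inr ?_
    rw [sym2_eq_mk_of_mem_of_mem hxe hv hxv.symm, Sym2.eq_swap]

/-- If moreover both apex pairs have parameter `0`, then almost surely `x` is isolated.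
[cite: Grimmett2006, §1.4 eq. (1.20) (p. 15)] -/
theorem isolated_of_rcWeightW_ne_zero (w : Sym2 V → unitInterval) (q : ℝ) {u v x : V} (hxu : x ≠ u) (hxv : x ≠ v)
    (hw : ∀ e : Sym2 V, x ∈ e → ((w e : unitInterval) : ℝ) ≠ 0 → u ∈ e ∨ v ∈ e)
    (ha : ((w s(u, x) : unitInterval) : ℝ) = 0) (hb : ((w s(x, v) : unitInterval) : ℝ) = 0)
    {ω : BondConfig V} (hω : rcWeightW w q ∅ ω ≠ 0) : ∀ e ∈ ω, x ∉ e := by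
  intro e he hxe
  rcases apex_of_rcWeightW_ne_zero w q hxu hxv hw hω e he hxe with rfl | rfl
  · exact not_mem_of_rcWeightW_ne_zero w q ha hω he
  · exact not_mem_of_rcWeightW_ne_zero w q hb hω he

omit [Fintype V] in
/-- The apex hypothesis is stable under updating a pair that is off `x` or contains `u` or `v`. [folklore] -/
theorem apex_hyp_update {w : Sym2 V → unitInterval} {u v x : V}
    (hw : ∀ e : Sym2 V, x ∈ e → ((w e : unitInterval) : ℝ) ≠ 0 → u ∈ e ∨ v ∈ e)
    (f : Sym2 V) (hf : x ∈ f → u ∈ f ∨ v ∈ f) (c : unitInterval) :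
    ∀ e : Sym2 V, x ∈ e → ((Function.update w f c e : unitInterval) : ℝ) ≠ 0 → u ∈ e ∨ v ∈ e := by
  intro e hxe hne
  by_cases hef : e = f
  · subst hef; exact hf hxe
  · rw [Function.update_of_ne hef] at hne
    exact hw e hxe hne

/-! ### The apex events and their insensitivity -/

omit [Fintype V] in
/-- `u ↔ v` avoiding the apex pairs is insensitive to the apex pairs. [folklore] -/
theorem symmDiff_apex_diff (ω : BondConfig V) (u v x : V) {e : Sym2 V} (he : e = s(u, x) ∨ e = s(x, v)) :
    (ω ∆ {e}) \ {s(u, x), s(x, v)} = ω \ {s(u, x), s(x, v)} := by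
  ext f
  simp only [Set.mem_sdiff, Set.mem_symmDiff, Set.mem_singleton_iff, Set.mem_insert_iff]
  constructor
  · rintro ⟨hf | hf, hn⟩
    · exact ⟨hf.1, hn⟩
    · rcases he with rfl | rfl
      · exact absurd (Or.inl hf.1) hn
      · exact absurd (Or.inr hf.1) hn
  · rintro ⟨hf, hn⟩
    refine ⟨Or.inl ⟨hf, fun h => ?_⟩, hn⟩
    rcases he with rfl | rfl
    · exact hn (Or.inl h)
    · exact hn (Or.inr h)

omit [Fintype V] in
/-- Toggling a pair `e` does not change membership of another pair `f ≠ e`. [folklore] -/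
theorem mem_symmDiff_singleton_of_ne (ω : BondConfig V) {e f : Sym2 V} (hfe : f ≠ e) : f ∈ ω ∆ {e} ↔ f ∈ ω := by
  simp [Set.mem_symmDiff, hfe]

end FK

end Summit.CriticalPhenomena.PercolationContinuityZ3.Theorems

end
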